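import Summits.Ventures.PercRepro.ProfilePointedCircuitClassesStarSharpD0F

/-!
# PercRepro — CASE D0 OF `StarNineSharp`, PART L: THE STRUCTURE LEMMAS WITH «NO ON LINE THROUGH `e`» ONLY (I)
(p5, gen 54; `proofs/P5-GM1.md` §81 ADD 1)

Submodularity alone gives `ρ((S₁ ∩ S₂) ∪ {b, b′}) ≤ 3` for two ON rank-`3` sets with a rank-`4` union
(`rk_inter_bb'_le_three_of_two_on`); when `e` lies in both, «no ON line through `e`» gives `ρ(S₁ ∩ S₂) ≤ 1`
(`rk_inter_le_one_of_two_on_e`).  A set containing an ON line is ON (`on_of_subset_on_line`).  The point of rule R3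
exists under the weaker hypothesis (`r3_point_exists'`).  The three lemmas of the «opposite vertex» refinement of
R3 for the cuts with ON lines avoiding `e`: L1 `opp_in_coff_of_on_line` (when `W = X ∖ (π + t)` is an ON line the
third point `t` of the demand plane is an OFF C-point, else the swap `π + f` would be an ON target), L2
`on_line_of_two_endpoints` (two demands sharing an endpoint `x` with `ρ(X − x) = 4` force `W` to be an ON line), L3
`third_in_coff` (two demands `{x, y}`, `{y, z}` of one plane with `x ∈ C` have `z ∈ C_OFF`).
-/

open scoped Matroid

namespace PercRepro.Cogirth

open Finset ThmH Skew Shadow Profile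

variable {α : Type} [DecidableEq α] {N : Matroid α} [N.Finite]

section StarSharpD0L

variable {b b' : α}

/-- Submodularity: two ON sets of rank `3` with a union of rank `4` have `ρ((S₁ ∩ S₂) ∪ {b, b′}) ≤ 3`. -/
theorem rk_inter_bb'_le_three_of_two_on (h : SeriesPair N b b') (hR : rk N (gr N) = 5)
    {S₁ S₂ : Finset α} (hS₁ : S₁ ⊆ ((gr N).erase b).erase b') (hS₂ : S₂ ⊆ ((gr N).erase b).erase b')
    (hon₁ : rk N (insert b (insert b' S₁)) = 4) (hon₂ : rk N (insert b (insert b' S₂)) = 4)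
    (hU : rk N (S₁ ∪ S₂) = 4) : rk N (insert b (insert b' (S₁ ∩ S₂))) ≤ 3 := by
  have hU' : rk N (insert b (insert b' (S₁ ∪ S₂))) = 5 := by
    have := rk_insert_bb'_bounds h (union_subset hS₁ hS₂)
    have h5 : rk N (insert b (insert b' (S₁ ∪ S₂))) ≤ 5 := by
      rw [← hR]
      exact rk_mono' (M := N) (insert_subset h.1 (insert_subset h.2.1
        ((union_subset hS₁ hS₂).trans ((erase_subset _ _).trans (erase_subset _ _)))))
    omega
  have hsub := rk_inter_add_rk_union_le' (M := N) (insert b (insert b' S₁)) (insert b (insert b' S₂))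
  have e1 : insert b (insert b' S₁) ∩ insert b (insert b' S₂) = insert b (insert b' (S₁ ∩ S₂)) := by
    ext x; simp only [mem_inter, mem_insert]; tauto
  have e2 : insert b (insert b' S₁) ∪ insert b (insert b' S₂) = insert b (insert b' (S₁ ∪ S₂)) := by
    ext x; simp only [mem_union, mem_insert]; tauto
  rw [e1, e2, hU', hon₁, hon₂] at hsub
  omega

/-- With no ON line through `e`: two ON sets of rank `3` through `e` with a union of rank `4` meet in rank `≤ 1`. -/
theorem rk_inter_le_one_of_two_on_e (h : SeriesPair N b b') (hR : rk N (gr N) = 5) {e : α}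
    (hnle : ∀ S : Finset α, S ⊆ ((gr N).erase b).erase b' → e ∈ S → rk N (insert b (insert b' S)) ≤ 3 → rk N S ≤ 1)
    {S₁ S₂ : Finset α} (hS₁ : S₁ ⊆ ((gr N).erase b).erase b') (hS₂ : S₂ ⊆ ((gr N).erase b).erase b')
    (he₁ : e ∈ S₁) (he₂ : e ∈ S₂)
    (hon₁ : rk N (insert b (insert b' S₁)) = 4) (hon₂ : rk N (insert b (insert b' S₂)) = 4)
    (hU : rk N (S₁ ∪ S₂) = 4) : rk N (S₁ ∩ S₂) ≤ 1 :=
  hnle _ ((inter_subset_left).trans hS₁) (mem_inter.2 ⟨he₁, he₂⟩)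
    (rk_inter_bb'_le_three_of_two_on h hR hS₁ hS₂ hon₁ hon₂ hU)

/-- A rank-`3` set containing an ON line (`ρ(W ∪ {b, b′}) = 3`, `ρ(W) = 2`) is ON. -/
theorem on_of_subset_on_line {S W : Finset α} (hW : W ⊆ S) (hW2 : rk N W = 2)
    (hWon : rk N (insert b (insert b' W)) = 3) (hS3 : rk N S = 3) : rk N (insert b (insert b' S)) ≤ 4 := by
  have h1 := rk_union_add_rk_le_of_subset_inter' (N := N) (S := S) (T := insert b (insert b' W)) (I := W)
    (by intro x hx; exact mem_inter.2 ⟨hW hx, mem_insert_of_mem (mem_insert_of_mem hx)⟩)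
  have e1 : S ∪ insert b (insert b' W) = insert b (insert b' S) := by
    ext x; simp only [mem_union, mem_insert]
    constructor
    · rintro (hx | rfl | rfl | hx)
      · exact Or.inr (Or.inr hx)
      · exact Or.inl rfl
      · exact Or.inr (Or.inl rfl)
      · exact Or.inr (Or.inr (hW hx))
    · rintro (rfl | rfl | hx)
      · exact Or.inr (Or.inl rfl)
      · exact Or.inr (Or.inr (Or.inl rfl))
      · exact Or.inl hx
  rw [e1, hWon, hW2, hS3] at h1
  omega

/-- **THE POINT OF RULE R3, WITH «NO ON LINE THROUGH `e`» ONLY** (copy of D0B's `r3_point_exists`): let `π = {x, y} ⊆ X` with `π + e` of rank `3`, `(X ∖ π) + f` of rank `4`,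
`π + e` ON, `ρ(π + e + f) = 4` and `X ∖ π` ON.  Then some `x ∈ π` has `ρ{e, f, x} = 3`, `ρ(X − x) = 4` and
`{e, f, x}` OFF. -/
theorem r3_point_exists' (h : SeriesPair N b b') (hn : (gr N).card = 9) (hR : rk N (gr N) = 5) {e f : α}
    (hnle : ∀ S : Finset α, S ⊆ ((gr N).erase b).erase b' → e ∈ S → rk N (insert b (insert b' S)) ≤ 3 → rk N S ≤ 1) (he : e ∈ gr N) (hf : f ∈ gr N) (hef : e ≠ f) (heb : e ≠ b) (heb' : e ≠ b') (hfb : f ≠ b) (hfb' : f ≠ b')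
    (he1 : ∀ y ∈ ((((gr N).erase b).erase b').erase f).erase e, rk N {e, y} = 2)
    (hX : rk N (((((gr N).erase b).erase b').erase f).erase e) = 4)
    {π : Finset α} (hπ : π ⊆ ((((gr N).erase b).erase b').erase f).erase e) (hπ2 : π.card = 2)
    (hYc : rk N (insert f (((((gr N).erase b).erase b').erase f).erase e \ π)) = 4)
    (hYon : rk N (insert b (insert b' (insert e π))) = 4)
    (hef4 : rk N (insert f (insert e π)) = 4)
    (hcon : rk N (insert b (insert b' (((((gr N).erase b).erase b').erase f).erase e \ π))) = 4) :
    ∃ x ∈ π, rk N {e, f, x} = 3 ∧ rk N ((((((gr N).erase b).erase b').erase f).erase e).erase x) = 4 ∧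
      rk N (insert b (insert b' {e, f, x})) = 5 := by
  have _ := hcon
  set X := ((((gr N).erase b).erase b').erase f).erase e with hXdef
  have hXE : X ⊆ ((gr N).erase b).erase b' := (erase_subset _ _).trans (erase_subset _ _)
  have hπE : π ⊆ ((gr N).erase b).erase b' := hπ.trans hXE
  have heE : e ∈ ((gr N).erase b).erase b' := mem_erase.2 ⟨heb', mem_erase.2 ⟨heb, he⟩⟩
  have hfE : f ∈ ((gr N).erase b).erase b' := mem_erase.2 ⟨hfb', mem_erase.2 ⟨hfb, hf⟩⟩
  have hE7 : (((gr N).erase b).erase b').card = 7 := by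
    rw [card_erase_of_mem (mem_erase.2 ⟨h.2.2.1.symm, h.2.1⟩), card_erase_of_mem h.1, hn]
  have hXc : X.card = 5 := by
    rw [hXdef, card_erase_of_mem (mem_erase.2 ⟨hef, heE⟩), card_erase_of_mem hfE, hE7]
  obtain ⟨x, y, hxy, rfl⟩ := card_eq_two.1 hπ2
  have hxX : x ∈ X := hπ (mem_insert_self _ _)
  have hyX : y ∈ X := hπ (mem_insert_of_mem (mem_singleton_self _))
  have hxe : x ≠ e := fun h' => (mem_erase.1 hxX).1 h'
  have hye : y ≠ e := fun h' => (mem_erase.1 hyX).1 h'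
  have hxf : x ≠ f := fun h' => (mem_erase.1 (mem_erase.1 hxX).2).1 h'
  have hyf : y ≠ f := fun h' => (mem_erase.1 (mem_erase.1 hyX).2).1 h'
  -- every 3-subset of `{e, f, x, y}` (rank 4 = card) has rank 3
  have hfn : f ∉ insert e ({x, y} : Finset α) := by
    simp only [mem_insert, mem_singleton, not_or]; exact ⟨hef.symm, hxf.symm, hyf.symm⟩
  have hen : e ∉ ({x, y} : Finset α) := by
    simp only [mem_insert, mem_singleton, not_or]; exact ⟨hxe.symm, hye.symm⟩
  have hcard4 : (insert f (insert e ({x, y} : Finset α))).card = 4 := by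
    rw [card_insert_of_notMem hfn, card_insert_of_notMem hen, card_pair hxy]
  have hfull : rk N (insert f (insert e ({x, y} : Finset α))) = (insert f (insert e ({x, y} : Finset α))).card := by
    rw [hef4, hcard4]
  have hefx : rk N {e, f, x} = 3 := by
    have := rk_eq_card_of_subset_of_rk_eq_card (M := N) (X := {e, f, x}) (by
      intro z hz; simp only [mem_insert, mem_singleton] at hz ⊢; tauto) hfull
    have hn' : e ∉ ({f, x} : Finset α) := by
      simp only [mem_insert, mem_singleton, not_or]; exact ⟨hef, hxe.symm⟩
    rw [this, card_insert_of_notMem hn', card_pair hxf.symm]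
  have hefy : rk N {e, f, y} = 3 := by
    have := rk_eq_card_of_subset_of_rk_eq_card (M := N) (X := {e, f, y}) (by
      intro z hz; simp only [mem_insert, mem_singleton] at hz ⊢; tauto) hfull
    have hn' : e ∉ ({f, y} : Finset α) := by
      simp only [mem_insert, mem_singleton, not_or]; exact ⟨hef, hye.symm⟩
    rw [this, card_insert_of_notMem hn', card_pair hyf.symm]
  -- OFF: `{e, f, z}` ON together with `π + e` ON would force the line `{e, z}` (F1′)
  have key : ∀ z, z ∈ X → rk N {e, f, z} = 3 →
      ({e, f, z} : Finset α) ∪ insert e {x, y} = insert f (insert e {x, y}) →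
      ({e, z} : Finset α) ⊆ {e, f, z} ∩ insert e {x, y} → rk N (insert b (insert b' {e, f, z})) = 5 := by
    intro z hzX hefz e1 hsub
    have hzE : z ∈ ((gr N).erase b).erase b' := hXE hzX
    have hzS : ({e, f, z} : Finset α) ⊆ ((gr N).erase b).erase b' := by
      intro w hw; simp only [mem_insert, mem_singleton] at hw
      rcases hw with rfl | rfl | rfl <;> assumption
    apply rk_insert_bb'_eq_five_of_not_on h hzS hefz
    intro hon
    have hU : rk N ({e, f, z} ∪ insert e {x, y}) = 4 := by rw [e1, hef4]
    have hI := rk_inter_le_one_of_two_on_e h hR hnle hzS (insert_subset heE hπE) (mem_insert_self _ _)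
      (mem_insert_self _ _) hon hYon hU
    have hez : rk N {e, z} ≤ rk N ({e, f, z} ∩ insert e {x, y}) := rk_mono' (M := N) hsub
    have := he1 z hzX
    omega
  have hoffx : rk N (insert b (insert b' {e, f, x})) = 5 := by
    exact key x hxX hefx (union_efx_insert_e_pair e f x y) (pair_ex_subset_inter e f x y)
  have hoffy : rk N (insert b (insert b' {e, f, y})) = 5 := by
    exact key y hyX hefy (union_efy_insert_e_pair e f x y) (pair_ey_subset_inter e f x y)
  -- one of `X − x`, `X − y` has rank 4: submodularity on `S + x`, `S + y` with `S := X ∖ π`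
  have hSc : (X \ {x, y}).card = 3 := by rw [card_sdiff_of_subset hπ, hXc, hπ2]
  have hS3 : rk N (X \ {x, y}) = 3 := by
    have hc : (insert f (X \ {x, y})).card = 4 := by
      rw [card_insert_of_notMem (fun h' => (mem_erase.1 (mem_erase.1 (mem_sdiff.1 h').1).2).1 rfl), hSc]
    rw [rk_eq_card_of_subset_of_rk_eq_card (M := N) (subset_insert f _) (by rw [hYc, hc]), hSc]
  have hxS : x ∉ X \ {x, y} := fun h' => (mem_sdiff.1 h').2 (mem_insert_self _ _)
  have hyS : y ∉ X \ {x, y} := fun h' => (mem_sdiff.1 h').2 (mem_insert_of_mem (mem_singleton_self _))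
  have eXx : X.erase x = insert y (X \ {x, y}) := by
    ext w; simp only [mem_erase, mem_insert, mem_sdiff, mem_singleton, not_or]
    constructor
    · rintro ⟨hwx, hwX⟩
      by_cases hwy : w = y
      · exact Or.inl hwy
      · exact Or.inr ⟨hwX, hwx, hwy⟩
    · rintro (rfl | ⟨hwX, hwx, hwy⟩)
      · exact ⟨hxy.symm, hyX⟩
      · exact ⟨hwx, hwX⟩
  have eXy : X.erase y = insert x (X \ {x, y}) := by
    ext w; simp only [mem_erase, mem_insert, mem_sdiff, mem_singleton, not_or]
    constructor
    · rintro ⟨hwy, hwX⟩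
      by_cases hwx : w = x
      · exact Or.inl hwx
      · exact Or.inr ⟨hwX, hwx, hwy⟩
    · rintro (rfl | ⟨hwX, hwx, hwy⟩)
      · exact ⟨hxy, hxX⟩
      · exact ⟨hwy, hwX⟩
  have hsub := rk_inter_add_rk_union_le' (M := N) (insert x (X \ {x, y})) (insert y (X \ {x, y}))
  have eI : insert x (X \ {x, y}) ∩ insert y (X \ {x, y}) = X \ {x, y} := by
    ext w; simp only [mem_inter, mem_insert, mem_sdiff, mem_singleton, not_or]
    constructor
    · rintro ⟨h1 | h1, h2 | h2⟩
      · exact absurd (h1.symm.trans h2) hxy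
      · exact h2
      · exact h1
      · exact h1
    · intro hw; exact ⟨Or.inr hw, Or.inr hw⟩
  have eU : insert x (X \ {x, y}) ∪ insert y (X \ {x, y}) = X := by
    ext w; simp only [mem_union, mem_insert, mem_sdiff, mem_singleton, not_or]
    constructor
    · rintro ((rfl | hw) | (rfl | hw))
      · exact hxX
      · exact hw.1
      · exact hyX
      · exact hw.1
    · intro hw
      by_cases hwx : w = x
      · exact Or.inl (Or.inl hwx)
      by_cases hwy : w = y
      · exact Or.inr (Or.inl hwy)
      exact Or.inl (Or.inr ⟨hw, hwx, hwy⟩)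
  rw [eI, eU, hS3, hX] at hsub
  have hxle : rk N (insert x (X \ {x, y})) ≤ 4 := by
    have := rk_le_card' (M := N) (insert x (X \ {x, y}))
    rw [card_insert_of_notMem hxS, hSc] at this; exact this
  have hyle : rk N (insert y (X \ {x, y})) ≤ 4 := by
    have := rk_le_card' (M := N) (insert y (X \ {x, y}))
    rw [card_insert_of_notMem hyS, hSc] at this; exact this
  by_cases hx4 : rk N (insert y (X \ {x, y})) = 4
  · exact ⟨x, mem_insert_self _ _, hefx, by rw [eXx]; exact hx4, hoffx⟩
  · refine ⟨y, mem_insert_of_mem (mem_singleton_self _), hefy, ?_, hoffy⟩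
    rw [eXy]; omega


/-- `f` cannot lie in the closure of `{e, t}` when `ρ(π + e + f) = 4` and `t ∈ cl(π + e)`. -/
theorem rk_eft_eq_three_of_plane {e f t : α} {π : Finset α} (het : rk N {e, t} = 2)
    (hef4 : rk N (insert f (insert e π)) = 4) (htH : rk N (insert t (insert e π)) = 3) : rk N {e, f, t} = 3 := by
  by_contra hne
  have h1 : rk N (insert f {e, t}) = rk N {e, t} := by
    have e1 : insert f ({e, t} : Finset α) = {f, e, t} := rfl
    have hle : rk N {e, f, t} ≤ 3 := by
      have := rk_le_card' (M := N) {e, f, t}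
      refine this.trans ?_
      exact (card_insert_le _ _).trans (Nat.succ_le_succ ((card_insert_le _ _).trans (by rw [card_singleton])))
    have hm : rk N {e, t} ≤ rk N {e, f, t} := rk_mono' (M := N) (pair_et_subset_eft e f t)
    rw [e1, triple_swap12]; omega
  have h2 := rk_insert_union_eq_of_rk_insert_eq' (N := N) (T := insert t (insert e π)) h1
  have e2 : ({e, t} : Finset α) ∪ insert t (insert e π) = insert t (insert e π) := by
    ext w; simp only [mem_union, mem_insert, mem_singleton]; tauto
  rw [e2, htH] at h2
  have h3 : rk N (insert f (insert e π)) ≤ rk N (insert f (insert t (insert e π))) := rk_mono' (M := N)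
    (insert_subset_insert f (subset_insert t _))
  omega

/-- `π ∪ W ∪ insert e π = insert e (π ∪ W)`. -/
theorem union_insert_eq_insert_union' (π W : Finset α) (e : α) : π ∪ W ∪ insert e π = insert e (π ∪ W) := by
  ext w; simp only [mem_union, mem_insert]; tauto

/-- `insert e π ∪ insert e (π ∪ W) = insert e (π ∪ W)`. -/
theorem insert_union_insert_union_eq (π W : Finset α) (e : α) : insert e π ∪ insert e (π ∪ W) = insert e (π ∪ W) := by
  ext w; simp only [mem_union, mem_insert]; tauto

/-- `{e, f, t} ∪ insert t (insert e π) = insert t (insert f (insert e π))`. -/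
theorem union_eft_insert_eq (e f t : α) (π : Finset α) :
    ({e, f, t} : Finset α) ∪ insert t (insert e π) = insert t (insert f (insert e π)) := by
  ext w; simp only [mem_union, mem_insert, mem_singleton]; tauto

/-- `insert t (insert e π ∪ {b, b'}) = insert b (insert b' (insert t (insert e π)))`. -/
theorem insert_t_union_bb'_eq (b b' e t : α) (π : Finset α) :
    insert t (insert e π ∪ {b, b'}) = insert b (insert b' (insert t (insert e π))) := by
  ext w; simp only [mem_insert, mem_union, mem_singleton]; tauto

/-- `insert e π ∪ {b, b'} = insert b (insert b' (insert e π))`. -/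
theorem insert_e_union_bb'_eq (b b' e : α) (π : Finset α) :
    insert e π ∪ {b, b'} = insert b (insert b' (insert e π)) := by
  ext w; simp only [mem_insert, mem_union, mem_singleton]; tauto

/-- `insert f (insert e π) = insert e (insert f π)`. -/
theorem insert_f_insert_e_comm (e f : α) (π : Finset α) : insert f (insert e π) = insert e (insert f π) := by
  ext w; simp only [mem_insert]; tauto

/-- `insert b (insert b' (insert f π)) = insert f (insert b (insert b' π))`. -/
theorem insert_bb'_f_comm (b b' f : α) (π : Finset α) :
    insert b (insert b' (insert f π)) = insert f (insert b (insert b' π)) := by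
  ext w; simp only [mem_insert]; tauto

/-- `(π ∪ W) ∩ insert e π = π` when `e ∉ W`. -/
theorem union_inter_insert_eq {π W : Finset α} {e : α} (heW : e ∉ W) : (π ∪ W) ∩ insert e π = π := by
  ext w; simp only [mem_inter, mem_union, mem_insert]
  constructor
  · rintro ⟨hw | hw, rfl | hw'⟩
    · exact hw
    · exact hw
    · exact absurd hw heW
    · exact hw'
  · intro hw; exact ⟨Or.inl hw, Or.inr hw⟩

/-- `insert b (insert b' π) ⊆ π ∪ W ∪ insert b (insert b' W)`. -/
theorem insert_bb'_subset_union (b b' : α) (π W : Finset α) :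
    insert b (insert b' π) ⊆ π ∪ W ∪ insert b (insert b' W) := by
  intro w hw; simp only [mem_insert, mem_union] at hw ⊢; tauto

/-- **L2**: two demands `{x, y₁} + e`, `{x, y₂} + e` (`y₁ ≠ y₂`) with ON complements and `ρ(X − x) = 4` force
`W := X − x − y₁ − y₂` to be an ON line (`ρ(W) = 2`, `ρ(W ∪ {b, b′}) = 3`). -/
theorem on_line_of_two_endpoints (h : SeriesPair N b b') (hR : rk N (gr N) = 5) {e f x y₁ y₂ : α} (hy : y₁ ≠ y₂)
    (hy₁ : y₁ ∈ ((((gr N).erase b).erase b').erase f).erase e) (hy₂ : y₂ ∈ ((((gr N).erase b).erase b').erase f).erase e)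
    (hcon₁ : rk N (insert b (insert b' (((((gr N).erase b).erase b').erase f).erase e \ {x, y₁}))) = 4)
    (hcon₂ : rk N (insert b (insert b' (((((gr N).erase b).erase b').erase f).erase e \ {x, y₂}))) = 4)
    (hx4 : rk N ((((((gr N).erase b).erase b').erase f).erase e).erase x) = 4) :
    rk N (((((((gr N).erase b).erase b').erase f).erase e).erase x) \ {y₁, y₂}) = 2 ∧
      rk N (insert b (insert b' (((((((gr N).erase b).erase b').erase f).erase e).erase x) \ {y₁, y₂}))) = 3 := by
  set X := ((((gr N).erase b).erase b').erase f).erase e with hXdef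
  have hXE : X ⊆ ((gr N).erase b).erase b' := (erase_subset _ _).trans (erase_subset _ _)
  have hXg : X ⊆ gr N := hXE.trans ((erase_subset _ _).trans (erase_subset _ _))
  have eU : X \ {x, y₁} ∪ X \ {x, y₂} = X.erase x := by
    ext w; simp only [mem_union, mem_sdiff, mem_insert, mem_singleton, not_or, mem_erase]
    constructor
    · rintro (⟨hw, h1, h2⟩ | ⟨hw, h1, h2⟩) <;> exact ⟨h1, hw⟩
    · rintro ⟨hwx, hw⟩
      by_cases h1 : w = y₁
      · exact Or.inr ⟨hw, hwx, h1 ▸ hy⟩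
      · exact Or.inl ⟨hw, hwx, h1⟩
  have hU : rk N (X \ {x, y₁} ∪ X \ {x, y₂}) = 4 := by rw [eU]; exact hx4
  have hI := rk_inter_bb'_le_three_of_two_on h hR (sdiff_subset.trans hXE) (sdiff_subset.trans hXE) hcon₁ hcon₂ hU
  have eI : X \ {x, y₁} ∩ (X \ {x, y₂}) = (X.erase x) \ {y₁, y₂} := by
    ext w; simp only [mem_inter, mem_sdiff, mem_insert, mem_singleton, not_or, mem_erase]
    tauto
  rw [eI] at hI
  set W := (X.erase x) \ {y₁, y₂} with hWdef
  have hWE : W ⊆ ((gr N).erase b).erase b' := sdiff_subset.trans ((erase_subset _ _).trans hXE)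
  have hWg : W ⊆ gr N := hWE.trans ((erase_subset _ _).trans (erase_subset _ _))
  have hsub : X.erase x ⊆ insert y₁ (insert y₂ W) := by
    intro w hw
    simp only [mem_insert, hWdef, mem_sdiff, mem_singleton, not_or]
    by_cases h1 : w = y₁
    · exact Or.inl h1
    by_cases h2 : w = y₂
    · exact Or.inr (Or.inl h2)
    exact Or.inr (Or.inr ⟨hw, h1, h2⟩)
  have h1 : rk N (insert y₂ W) ≤ rk N W + 1 := rk_insert_le_add_one (hXg hy₂) hWg
  have h2 : rk N (insert y₁ (insert y₂ W)) ≤ rk N (insert y₂ W) + 1 :=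
    rk_insert_le_add_one (hXg hy₁) (insert_subset (hXg hy₂) hWg)
  have h3 : rk N (X.erase x) ≤ rk N (insert y₁ (insert y₂ W)) := rk_mono' (M := N) hsub
  have h4 := rk_insert_bb'_bounds h hWE
  omega

end StarSharpD0L

end PercRepro.Cogirth
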